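import Literature.MathematicalPhysics.QuantumFieldTheory.Balaban1983to89.B8DentedCubeMemberBoxTowers
import Literature.MathematicalPhysics.QuantumFieldTheory.Balaban1983to89.B8Eq1101CubeMemberCutoffs

/-!
# `Balaban1983to89.B8DentedCubeMemberCutoffsWall` — [Balaban1984PropagatorsII] (2.47)–(2.48) ∕ [Balaban1985RegularSpaces] p. 98 ON THE DENTED CUBE MEMBER of
# [Balaban1985Variational] (148)–(150): THE WALL `W` OF THE TWO-REGION PARAMETRIX CARRIES THE DENTED TOWER STRUCTURE, WITH LEVELS `≤ 1` — dented twins of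
# dag-n05-c's F4a `B8Eq1101CubeMemberCutoffs` §5 (`wall_level_le_one`, `wall_hfull`, `wall_hdisj`, `wall_hcover`, `wall_hlow`, `wall_row`)

statement-level skeleton of published theorems with citation tags; proofs where landed; nothing here is a claim about the Yang–Mills mass gap

`[Balaban1984PropagatorsII]` ("B6", CMP **96** (1984) 223–250) p. 230, (2.46)–(2.48) p. 231; `[Balaban1985RegularSpaces]` ("B8" = [6], CMP **99** (1985) 75–102) p. 98,
(1.131) p. 99, (1.5)–(1.6) p. 77; `[Balaban1985Variational]` ("[15]", CMP **102** (1985) 277–309) (148)–(151) p. 301.  PDF held: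
`paper:balaban1985-cmp99-regular-spaces-gauge-fixing`, `paper:balaban1985-cmp102-variational-background`.

CITATION HEADER (lean-in-tree rule).  Cell `pub-ymgap` (YM Track A, HUMAN RULING D-0062), DAG node N05 = [B8], seat `pub-ymgap-dag-n05-e` (g32; FAN-OUT §N05 row s3b,
Proposition-6 lane; piece (d2-f) of the (β) road — the dented parametrix, file 1: g31 HANDOFF «Next 1 (iii)», dag-n05-c STANDING GO I.42366, this seat INTENT I.43617).
WHY THIS FILE.  dag-n05-c's two-region parametrix for (1.101) on the cube member (`B8Eq1101CubeMember{Cutoffs,ParametrixIdentity,Real,…}`) inverts the consumer's flat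
matrix on the WALL `W ⊂ □₀ ∖ □₂` by F3 `B8Eq191FlatDirichletWall.wall_rowBound`, which takes four structural hypotheses on the restriction sets over `W` (`hfull`, `hdisj`,
`hcover`, `hlow`); F4a §5 supplies them for [6]'s cells `cubeLamS`.  The wall `wall hd L a M ρ k S m_W` itself depends only on `□₀`, `□₁`; THIS FILE supplies the four
hypotheses and the row lemma for NODE 00's DENTED cells `c.lamS` (p655171) — by g31's dented cover ∕ disjointness (`cover_dented`, `towers_disjoint_dented`) and this
seat's `mem_cube_of_tower` ∕ `towerBlock_subset_sq_zero` (p673253) — so that the parametrix twins (next files) are token re-keys.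

WHAT THIS FILE PROVES (kernel-checked; `L = ℓ + 1`; `c : Node00.CubeB8D (d+1) (ℓ+1) K Ω`; `S ↔ c.sq 0`; wall parameter `m_W` with `m_W + (d+1)ℓ ≤ ρL`).
`wall_level_le_one` (a wall site at dented tower level `j` has `j ≤ 1`), `wall_hfull`, `wall_hdisj`, `wall_hcover`, `wall_hlow`, ★ `wall_row` (the row of a near-wall site
sees only the wall) — F4a §5 verbatim with the dented suppliers.
HONEST SCOPE ∕ NOT CLAIMED.  Lattice bookkeeping; no estimate.  Count-neutral; N05 ∕ N07 NOT discharged; one finite `T⁴` programme at fixed `ε`, Bałaban as printed; nothing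
continuum ∕ ℝ⁴ ∕ OS ∕ mass-gap ∕ Clay.  No `sorry`, no `def`, no `instance`, no `notation`.  Unit `pub-ymgap-dag-n05-e` (g32), 2026-08-28.

RELATED IN THE TREE, NOT DUPLICATED (`rg -l 'DentedCubeMemberCutoffs' Balaban1983to89` = 0, 2026-08-28T22:45Z): F4a `B8Eq1101CubeMemberCutoffs` (dag-n05-c; `wall` and its
structure-free lemmas USED by name; §5 the model), `B8DentedCubeMemberBoxTowers` (g32; USED), `B8Eq192DentedCubeMemberOfReal1G.cover_dented`,
`B8Eq191FlatLettersDentedCubeMember.towers_disjoint_dented` (g31; USED).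
-/
noncomputable section

namespace Literature.MathematicalPhysics.QuantumFieldTheory.Balaban1983to89.B8DentedCubeMemberCutoffsWall

open B7Prop1Explicit (e)
open B8Eq131Cubes (cube cube_anti)
open B8Eq191FlatDirichletDepth (depth)
open B8Eq191FlatLettersDentedCubeMember (towers_disjoint_dented)
open B8Eq192DentedCubeMemberOfReal1G (cover_dented)
open B8DentedCubeMemberZd (lamST_top)
open B8DentedCubeMemberBoxTowers (mem_cube_of_tower towerBlock_subset_sq_zero)
open B8Eq1101CubeMemberCutoffs (wall wall_subset mem_wall_of_depth_le mem_wall_of_blockMap_eq not_mem_cube_two_of_mem_wall blockMap_pow_zero abs_depth_sub_step_le)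
open Node00 (CubeB8D)
open Literature.MathematicalPhysics.QuantumLattice (blockMap)

variable {d : ℕ}

section WallTowers

variable {ℓ K : ℕ} {Ω : ℕ → Set (Fin (d + 1) → ℤ)} (c : CubeB8D (d + 1) (ℓ + 1) K Ω)

/-- LEVELS ON THE WALL ARE `≤ 1` (when `m_W + (d+1)ℓ ≤ ρL`): a wall site at dented tower level `j` has `j ≤ 1` (a level-`j` cell block lies in `□_j ⊆ □₂` for `j ≥ 2`,
the wall misses `□₂`). [cite: Balaban1985RegularSpaces, p.98, (1.131) p.99; Balaban1985Variational, (148)–(150) p.301] -/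
theorem wall_level_le_one (hd : 0 < d + 1) (S : Finset (Fin (d + 1) → ℤ)) (mW : ℕ)
    (hmW : (mW : ℤ) + (d + 1 : ℕ) * ((ℓ + 1 : ℕ) - 1 : ℤ) ≤ c.ρ * (ℓ + 1 : ℕ)) {x : Fin (d + 1) → ℤ} (hx : x ∈ wall hd (ℓ + 1) c.a c.M c.ρ c.k S mW)
    {j : ℕ} (hj : j ≤ c.k) (hxj : blockMap ((ℓ + 1) ^ j) x ∈ c.lamS j) : j ≤ 1 := by
  by_contra h
  push Not at h
  have hk : 2 ≤ c.k := le_trans h hj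
  have h2 : x ∈ cube (ℓ + 1) c.a c.M c.ρ c.k 2 := cube_anti h hj (mem_cube_of_tower c hxj)
  exact not_mem_cube_two_of_mem_wall hd (Nat.succ_pos ℓ) c.a c.M c.ρ c.k S mW hk hmW hx h2

/-- `hfull` FOR THE WALL: live dented tower blocks of wall sites lie in the wall. [cite: Balaban1985RegularSpaces, p.98, (1.5)–(1.6) p.77; Balaban1985Variational, (148) p.301] -/
theorem wall_hfull (hd : 0 < d + 1) (S : Finset (Fin (d + 1) → ℤ)) (hS : ∀ x, x ∈ S ↔ x ∈ c.sq 0) (mW : ℕ)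
    (hmW : (mW : ℤ) + (d + 1 : ℕ) * ((ℓ + 1 : ℕ) - 1 : ℤ) ≤ c.ρ * (ℓ + 1 : ℕ)) :
    ∀ j, j ≤ c.k → ∀ x ∈ wall hd (ℓ + 1) c.a c.M c.ρ c.k S mW, blockMap ((ℓ + 1) ^ j) x ∈ c.lamS j →
      ∀ z, blockMap ((ℓ + 1) ^ j) z = blockMap ((ℓ + 1) ^ j) x → z ∈ wall hd (ℓ + 1) c.a c.M c.ρ c.k S mW := by
  intro j hj x hx hxj z hz
  have hj1 := wall_level_le_one c hd S mW hmW hx hj hxj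
  have hzS : z ∈ S := (hS z).mpr (towerBlock_subset_sq_zero c hj hxj hz)
  rcases Nat.le_one_iff_eq_zero_or_eq_one.mp hj1 with h0 | h1
  · subst h0
    rw [blockMap_pow_zero, blockMap_pow_zero] at hz
    rw [hz]; exact hx
  · subst h1
    have hx1 : x ∈ cube (ℓ + 1) c.a c.M c.ρ c.k 1 := mem_cube_of_tower c hxj
    have hz' : blockMap (ℓ + 1) z = blockMap (ℓ + 1) x := by rw [← pow_one (ℓ + 1)]; exact hz
    exact mem_wall_of_blockMap_eq hd (ℓ + 1) c.a c.M c.ρ c.k S mW hx hx1 hzS hz'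

/-- `hdisj` FOR THE WALL (one dented level per site), inherited from `□₀` (g31's `towers_disjoint_dented`). [cite: Balaban1985RegularSpaces, (1.5)–(1.6) p.77, (1.131) p.99; Balaban1985Variational, (148)–(150) p.301] -/
theorem wall_hdisj (hd : 0 < d + 1) (S : Finset (Fin (d + 1) → ℤ)) (hS : ∀ x, x ∈ S ↔ x ∈ c.sq 0) (mW : ℕ) :
    ∀ x ∈ wall hd (ℓ + 1) c.a c.M c.ρ c.k S mW, ∀ j, j ≤ c.k → ∀ j', j' ≤ c.k →
      blockMap ((ℓ + 1) ^ j) x ∈ c.lamS j → blockMap ((ℓ + 1) ^ j') x ∈ c.lamS j' → j = j' := by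
  have hdisj := towers_disjoint_dented c (Nat.succ_pos ℓ) le_rfl
  rw [lamST_top] at hdisj
  intro x hx j hj j' hj' h1 h2
  have hxS : x ∈ S := wall_subset hd (ℓ + 1) c.a c.M c.ρ c.k S mW hx
  exact (hdisj j hj j' hj' _ h1 _ h2 x ((hS x).mp hxS) rfl rfl).1

/-- `hcover` FOR THE WALL (every site lies in a dented tower), inherited from `□₀` (g31's `cover_dented`). [cite: Balaban1985RegularSpaces, (1.5)–(1.6) p.77, (1.131) p.99; Balaban1985Variational, (148)–(150) p.301] -/
theorem wall_hcover (hd : 0 < d + 1) (S : Finset (Fin (d + 1) → ℤ)) (hS : ∀ x, x ∈ S ↔ x ∈ c.sq 0) (mW : ℕ) :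
    ∀ x ∈ wall hd (ℓ + 1) c.a c.M c.ρ c.k S mW, ∃ j, j ≤ c.k ∧ blockMap ((ℓ + 1) ^ j) x ∈ c.lamS j := by
  intro x hx
  obtain ⟨j, hj, h⟩ := cover_dented c (Nat.succ_pos ℓ) le_rfl x ((hS x).mp (wall_subset hd (ℓ + 1) c.a c.M c.ρ c.k S mW hx))
  rw [lamST_top] at h
  exact ⟨j, hj, h⟩

/-- `hlow` FOR THE WALL. [cite: Balaban1985RegularSpaces, p.98; Balaban1985Variational, (150) p.301] -/
theorem wall_hlow (hd : 0 < d + 1) (S : Finset (Fin (d + 1) → ℤ)) (mW : ℕ) (hmW : (mW : ℤ) + (d + 1 : ℕ) * ((ℓ + 1 : ℕ) - 1 : ℤ) ≤ c.ρ * (ℓ + 1 : ℕ)) :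
    ∀ x ∈ wall hd (ℓ + 1) c.a c.M c.ρ c.k S mW, ∀ j, j ≤ c.k → blockMap ((ℓ + 1) ^ j) x ∈ c.lamS j → j ≤ 1 :=
  fun _ hx _ hj hxj => wall_level_le_one c hd S mW hmW hx hj hxj

/-- ★ THE ROW OF A NEAR-WALL SITE SEES ONLY THE WALL: if `x ∈ □₀` has depth₁ `≤ m_W − 1`, then `x ∈ W`, every neighbour of `x` in `□₀` is in `W`, and so is every
site of the live dented tower block of `x`. [cite: Balaban1985RegularSpaces, p.98; Balaban1984PropagatorsII, (2.48) p.231; Balaban1985Variational, (148)–(150) p.301] -/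
theorem wall_row (hd : 0 < d + 1) (S : Finset (Fin (d + 1) → ℤ)) (hS : ∀ x, x ∈ S ↔ x ∈ c.sq 0) (mW : ℕ)
    (hmW : (mW : ℤ) + (d + 1 : ℕ) * ((ℓ + 1 : ℕ) - 1 : ℤ) ≤ c.ρ * (ℓ + 1 : ℕ))
    {x : Fin (d + 1) → ℤ} (hx : x ∈ S) (hδ : depth hd (ℓ + 1) c.a c.M c.ρ c.k 1 x + 1 ≤ mW) :
    x ∈ wall hd (ℓ + 1) c.a c.M c.ρ c.k S mW ∧
    (∀ μ, (x + e μ ∈ S → x + e μ ∈ wall hd (ℓ + 1) c.a c.M c.ρ c.k S mW) ∧ (x - e μ ∈ S → x - e μ ∈ wall hd (ℓ + 1) c.a c.M c.ρ c.k S mW)) ∧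
    (∀ j, j ≤ c.k → blockMap ((ℓ + 1) ^ j) x ∈ c.lamS j →
      ∀ z, blockMap ((ℓ + 1) ^ j) z = blockMap ((ℓ + 1) ^ j) x → z ∈ wall hd (ℓ + 1) c.a c.M c.ρ c.k S mW) := by
  have hxW : x ∈ wall hd (ℓ + 1) c.a c.M c.ρ c.k S mW := mem_wall_of_depth_le hd (ℓ + 1) c.a c.M c.ρ c.k S mW hx (by omega)
  refine ⟨hxW, fun μ => ⟨fun h => ?_, fun h => ?_⟩, fun j hj hxj z hz => wall_hfull c hd S hS mW hmW j hj x hxW hxj z hz⟩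
  · have := (abs_depth_sub_step_le hd (ℓ + 1) c.a c.M c.ρ c.k 1 x μ).1
    rw [abs_le] at this
    exact mem_wall_of_depth_le hd (ℓ + 1) c.a c.M c.ρ c.k S mW h (by omega)
  · have := (abs_depth_sub_step_le hd (ℓ + 1) c.a c.M c.ρ c.k 1 x μ).2
    rw [abs_le] at this
    exact mem_wall_of_depth_le hd (ℓ + 1) c.a c.M c.ρ c.k S mW h (by omega)

end WallTowers

end Literature.MathematicalPhysics.QuantumFieldTheory.Balaban1983to89.B8DentedCubeMemberCutoffsWall
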